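/-
Copyright (c) 2026 the pub-hodgecm-mathlib formalisation cell (harness21).  Prover seat hodgecm-mathlib-K2E3-p12 (g4), Track B «K2-LIT» ∕ h413
(`stmt-HodgeConjecture-24833`), line `K2_E3_EllipticInputs`, unit U12-d, §L (Φ′-d, part 2): AN ISOTROPIC HERMITIAN PLANE IS HYPERBOLIC — `∃ P, ᵗ(σP)·H·P = antidiag(1,1)`.
2026-09-04.
-/
import Literature.AlgebraicGeometry.ShimuraVarieties.UnitaryAnisotropicLineFrame     -- ★ `hermForm`, `formCongr_apply_eq_hermForm` (Gram matrix of a frame)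
import HarnessLib

/-!
# K2_E3 road (h413), §L — (Φ′-d, part 2): a non-degenerate ISOTROPIC `σ`-hermitian form on `K²` is congruent to the hyperbolic plane `J₀ = !![0,1;1,0]`

Cell `pub/hodgecm-mathlib` (D-0151), Track B, seat K2E3-p12 (g4), §L line lead (road «U-iso-T»).  `--supports stmt-HodgeConjecture-24833 --as helper`; count-neutral plumbing
toward (L-B_U)′ `sig_K2E3UNilpotentFourierRegular` (U12 ED. 7 :373) at `N = 2`: with ★ p857270 `nilpotentFourierRegular_of_formCongr` (the :373 body is a congruence invariant) the
`N = 2` socket splits into the ANISOTROPIC normal forms (★ p856833) and the single isotropic normal form `J₀` (★ p857242 reads it on `𝔤𝔩₂(L⁺_v)`).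

* §1 `hermForm` is sesquilinear and `σ`-symmetric (`h(v,u) = σ h(u,v)` for `ᵗ(σH) = H`, `σ² = 1`); non-degeneracy `det H ≠ 0 ⇒ (∀ v, h(u,v) = 0) ⇒ u = 0` (any index type).
* §2 **`exists_formCongr_eq_hyperbolic`** — `σ² = 1`, `2 ≠ 0`, `H ∈ M₂(K)` `σ`-hermitian with `det H ≠ 0` and an isotropic `u ≠ 0` ⟹ `∃ P ∈ GL₂(K)`, `formCongr σ P H = !![0,1;1,0]`:
  the hyperbolic partner `v` (`h(u,v) = 1`) corrected to `v − (h(v,v)∕2)·u`; `P = [u ∣ v′]` is invertible because `σ(det P)·det H·det P = det J₀ = −1`.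
  **`anisotropic_or_exists_formCongr_eq_hyperbolic`** — the dichotomy used by the `N = 2` payer.

HONEST LABEL: HC_CM is proved only modulo the 7 printed citations (2 remaining named inputs: hLiu418 = stmt-HodgeConjecture-24832, h413 = stmt-HodgeConjecture-24833)
until rung 0 closes; count-neutral plumbing.

References: [Scharlau1985HermitianForms] W. Scharlau, *Quadratic and Hermitian Forms* (1985), Ch. 7 §1 (hyperbolic planes), Ch. 1 Lemma 3.4; [Dieudonne1971GroupesClassiques] J. Dieudonné,
*La géométrie des groupes classiques* (1971), Chap. I §11; [PlatonovRapinchuk1994] Platonov–Rapinchuk, *Algebraic Groups and Number Theory* (1994), §2.3.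
-/

set_option autoImplicit false
set_option linter.dupNamespace false   -- `Summit.HodgeConjecture.HodgeConjecture.…` (D-0017 nested layout; lakefile exemption for Summits)

open scoped Matrix MatrixGroups
open Literature.NumberTheory.Automorphic
open Literature.AlgebraicGeometry.ShimuraVarieties (hermForm formCongr_apply_eq_hermForm)

namespace Summit.HodgeConjecture.HodgeConjecture.Cruxes.H413.K2E3HermitianPlaneIsotropicCongr

/-! ## §1  Sesquilinearity, `σ`-symmetry, non-degeneracy -/

section Sesq

variable {K : Type*} [Field K] (σ : K →+* K) {n : Type*} [Fintype n]

/-- Unfolding: `h(u,v) = ᵗσ(u)·H·v`. [cite: Scharlau1985HermitianForms, Ch. 7 §1] -/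
theorem hermForm_def (H : Matrix n n K) (u v : n → K) : hermForm σ H u v = (σ ∘ u) ⬝ᵥ (H *ᵥ v) := rfl

/-- Additivity in the second variable. [cite: Scharlau1985HermitianForms, Ch. 7 §1] -/
theorem hermForm_add_right (H : Matrix n n K) (u v v' : n → K) : hermForm σ H u (v + v') = hermForm σ H u v + hermForm σ H u v' := by
  rw [hermForm_def, hermForm_def, hermForm_def, Matrix.mulVec_add, dotProduct_add]

/-- Linearity in the second variable. [cite: Scharlau1985HermitianForms, Ch. 7 §1] -/
theorem hermForm_smul_right (H : Matrix n n K) (c : K) (u v : n → K) : hermForm σ H u (c • v) = c * hermForm σ H u v := by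
  rw [hermForm_def, hermForm_def, Matrix.mulVec_smul, dotProduct_smul, smul_eq_mul]

/-- Subtraction of a multiple in the second variable. [cite: Scharlau1985HermitianForms, Ch. 7 §1] -/
theorem hermForm_sub_smul_right (H : Matrix n n K) (c : K) (u v w : n → K) :
    hermForm σ H u (v - c • w) = hermForm σ H u v - c * hermForm σ H u w := by
  rw [sub_eq_add_neg, ← neg_smul, hermForm_add_right, hermForm_smul_right, neg_mul, ← sub_eq_add_neg]

/-- `σ`-semilinearity in the first variable. [cite: Scharlau1985HermitianForms, Ch. 7 §1] -/
theorem hermForm_sub_smul_left (H : Matrix n n K) (c : K) (u v w : n → K) :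
    hermForm σ H (v - c • w) u = hermForm σ H v u - σ c * hermForm σ H w u := by
  rw [hermForm_def, hermForm_def, hermForm_def]
  have : (σ ∘ (v - c • w) : n → K) = (σ ∘ v) - σ c • (σ ∘ w) := by
    funext i; simp [map_sub, map_mul, smul_eq_mul]
  rw [this, sub_dotProduct, smul_dotProduct, smul_eq_mul]

/-- **`σ`-symmetry**: `h(v,u) = σ(h(u,v))` for `ᵗ(σH) = H` and `σ² = 1`. [cite: Scharlau1985HermitianForms, Ch. 7 §1] -/
theorem hermForm_swap (hσ : ∀ a, σ (σ a) = a) {H : Matrix n n K} (hH : (H.map σ)ᵀ = H) (u v : n → K) :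
    hermForm σ H v u = σ (hermForm σ H u v) := by
  have hij : ∀ i j, σ (H i j) = H j i := fun i j => by
    conv_rhs => rw [← hH]
    rfl
  simp only [hermForm_def, dotProduct, Matrix.mulVec, Function.comp_apply, map_sum, map_mul, hσ, Finset.mul_sum, hij]
  rw [Finset.sum_comm]
  exact Finset.sum_congr rfl fun i _ => Finset.sum_congr rfl fun j _ => by ring

/-- An isotropic value is `σ`-fixed: `σ(h(v,v)) = h(v,v)`. [cite: Scharlau1985HermitianForms, Ch. 7 §1] -/
theorem map_hermForm_self (hσ : ∀ a, σ (σ a) = a) {H : Matrix n n K} (hH : (H.map σ)ᵀ = H) (v : n → K) :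
    σ (hermForm σ H v v) = hermForm σ H v v :=
  (hermForm_swap σ hσ hH v v).symm

/-- **Non-degeneracy**: `det H ≠ 0` and `h(u, ·) = 0` force `u = 0`. [cite: Scharlau1985HermitianForms, Ch. 1 Lemma 3.4] -/
theorem eq_zero_of_forall_hermForm_eq_zero [DecidableEq n] {H : Matrix n n K} (hdet : H.det ≠ 0) {u : n → K} (hu : ∀ v, hermForm σ H u v = 0) : u = 0 := by
  have hrow : (σ ∘ u) ᵥ* H = 0 := by
    funext j
    have := hu (Pi.single j 1)
    rw [hermForm_def, Matrix.dotProduct_mulVec, dotProduct_single, mul_one] at this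
    exact this
  have hσu : (σ ∘ u : n → K) = 0 := Matrix.eq_zero_of_vecMul_eq_zero hdet hrow
  funext i
  have := congr_fun hσu i
  exact (map_eq_zero σ).1 this

end Sesq

/-! ## §2  The hyperbolic plane -/

section Plane

variable {K : Type*} [Field K] (σ : K →+* K)

/-- **AN ISOTROPIC NON-DEGENERATE HERMITIAN PLANE IS HYPERBOLIC**: for `σ² = 1`, `2 ≠ 0`, `H ∈ M₂(K)` with `ᵗ(σH) = H`, `det H ≠ 0`, and `u ≠ 0` with `h(u,u) = 0`, there is
`P ∈ GL₂(K)` with `ᵗ(σP)·H·P = !![0,1;1,0]`. [cite: Scharlau1985HermitianForms, Ch. 7 §1; Ch. 1 Lemma 3.4] [cite: Dieudonne1971GroupesClassiques, Chap. I §11] -/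
theorem exists_formCongr_eq_hyperbolic (hσ : ∀ a, σ (σ a) = a) (h2 : (2 : K) ≠ 0) {H : Matrix (Fin 2) (Fin 2) K} (hH : (H.map σ)ᵀ = H)
    (hdet : H.det ≠ 0) {u : Fin 2 → K} (hu0 : u ≠ 0) (hu : hermForm σ H u u = 0) :
    ∃ P : GL (Fin 2) K, formCongr σ P H = !![(0 : K), 1; 1, 0] := by
  classical
  -- a hyperbolic partner
  obtain ⟨v₀, hv₀⟩ : ∃ v, hermForm σ H u v ≠ 0 := by
    by_contra h
    push Not at h
    exact hu0 (eq_zero_of_forall_hermForm_eq_zero σ hdet h)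
  set v₁ : Fin 2 → K := (hermForm σ H u v₀)⁻¹ • v₀ with hv₁
  have huv₁ : hermForm σ H u v₁ = 1 := by rw [hv₁, hermForm_smul_right, inv_mul_cancel₀ hv₀]
  have hv₁u : hermForm σ H v₁ u = 1 := by rw [hermForm_swap σ hσ hH, huv₁, map_one]
  -- correct it to an isotropic partner
  set a : K := hermForm σ H v₁ v₁ / 2 with ha
  have haσ : σ a = a := by rw [ha, map_div₀, map_hermForm_self σ hσ hH, map_ofNat]
  set v : Fin 2 → K := v₁ - a • u with hv
  have huv : hermForm σ H u v = 1 := by rw [hv, hermForm_sub_smul_right, huv₁, hu, mul_zero, sub_zero]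
  have hvu : hermForm σ H v u = 1 := by rw [hermForm_swap σ hσ hH, huv, map_one]
  have hvv : hermForm σ H v v = 0 := by
    rw [hv, hermForm_sub_smul_right, hermForm_sub_smul_left, hermForm_sub_smul_left, hv₁u, hu, haσ, mul_zero, sub_zero, huv₁, mul_one, ha]
    field_simp
    ring
  -- the frame `P = [u ∣ v]`
  set P₀ : Matrix (Fin 2) (Fin 2) K := Matrix.of fun i j => (![u, v] : Fin 2 → Fin 2 → K) j i with hP₀
  have hc0 : (fun i => P₀ i 0) = u := funext fun i => by simp [hP₀]
  have hc1 : (fun i => P₀ i 1) = v := funext fun i => by simp [hP₀]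
  have hGram : (P₀.map σ)ᵀ * H * P₀ = !![(0 : K), 1; 1, 0] := by
    ext i j
    have hij : ((P₀.map σ)ᵀ * H * P₀) i j = hermForm σ H (fun k => P₀ k i) (fun k => P₀ k j) := by
      rw [Matrix.mul_assoc, Matrix.mul_apply]
      rfl
    rw [hij]
    fin_cases i <;> fin_cases j <;> simp [hc0, hc1, hu, huv, hvu, hvv]
  have hP₀det : P₀.det ≠ 0 := by
    intro h0
    have := congr_arg Matrix.det hGram
    rw [Matrix.det_mul, Matrix.det_mul, h0, mul_zero, Matrix.det_fin_two_of] at this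
    norm_num at this
  refine ⟨Matrix.GeneralLinearGroup.mkOfDetNeZero P₀ hP₀det, ?_⟩
  exact hGram

/-- **The dichotomy for hermitian planes**: a non-degenerate `σ`-hermitian `H ∈ M₂(K)` (`σ² = 1`, `2 ≠ 0`) is either ANISOTROPIC or congruent to the hyperbolic plane
`!![0,1;1,0]`. [cite: Scharlau1985HermitianForms, Ch. 7 §1] [cite: PlatonovRapinchuk1994, §2.3] -/
theorem anisotropic_or_exists_formCongr_eq_hyperbolic (hσ : ∀ a, σ (σ a) = a) (h2 : (2 : K) ≠ 0) {H : Matrix (Fin 2) (Fin 2) K}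
    (hH : (H.map σ)ᵀ = H) (hdet : H.det ≠ 0) :
    (∀ u : Fin 2 → K, hermForm σ H u u = 0 → u = 0) ∨ ∃ P : GL (Fin 2) K, formCongr σ P H = !![(0 : K), 1; 1, 0] := by
  by_cases h : ∀ u : Fin 2 → K, hermForm σ H u u = 0 → u = 0
  · exact Or.inl h
  · push Not at h
    obtain ⟨u, hu, hu0⟩ := h
    exact Or.inr (exists_formCongr_eq_hyperbolic σ hσ h2 hH hdet hu0 hu)

end Plane

end Summit.HodgeConjecture.HodgeConjecture.Cruxes.H413.K2E3HermitianPlaneIsotropicCongr
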